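/-
Origin: expansion seat `planner-pub-hodgecm-pv10-g5-0`, handover #6(5/6) 2026-08-18T15:21:38Z ; rewrite: ^import Pv10g5\.QuotientFunctions -> import HodgeCM.PerL34.QuotientFunctions (`HOME/pub-hodgecm-pv10-g5/lean/Pv10g5/HolomorphicDeck.lean`, md5 4ed6367c, 299 lines);
landed by the gen-8 packager in gate run 31 as `HodgeCM/PerL34/HolomorphicDeck.lean` (import ^import Pv10g5\.QuotientFunctions[ \t]*$→import HodgeCM.PerL34.QuotientFunctions ×1; stripped 4 #print/#check/#eval lines).
-/
/-
Origin: pub-hodgecm speedrun cell, seat pv10-g5 (DAG-NODE PROVER #10, gen 5), 2026-08-18.  STAGING for the tree import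
(LEAN-IN-TREE RULE 2026-08-18): tree-shaped (≤ 400 lines, docstring on every decl); proposed tree home = the manifold-quotient
engine module next to `QuotientManifold` / `QuotientHolomorphic` (see `HOME/pub-hodgecm-pv10-g5/MODULE-MAP-pv10.md`).
Target path: `HodgeCM/PerL34/HolomorphicDeck.lean`.
WIP import `Pv10g5.QuotientFunctions` ↦ `HodgeCM.PerL34.QuotientFunctions` at landing (ONE rewrite); the other
import is a tree module.  KERNEL, nothing cited, nothing posited.
-/
import Summits.HodgeConjecture.HodgeCM.PerL34.QuotientFunctions
import Summits.HodgeConjecture.HodgeCM.PerL34.QuotientInStages_2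

/-!
# Deck transformations and quotients in stages are `C^n`

General (Mathlib-level) half of PerL v5 §1.2 ll. 72–75 *"there is a neat normal `K_1 ⊂ K_f` of finite index with
`P^L_{Γ_1} → P^L_Γ` finite étale"*: pv10-g4 (`QuotientInStages`, `StagesCovering`) proved the GROUP-THEORETIC and
TOPOLOGICAL content — the deck group `D = Γ/Γ₁` acts on `Γ₁\X` (`deckHom`), `(Γ₁\X)/D ≃ₜ Γ\X` (`stagesHomeomorph`),
and `Γ₁\X → Γ\X` is a covering map with fibres `D`-torsors.  This file adds the DIFFERENTIABLE content for a `C^n`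
manifold `M` (any model `I`, any `n`, e.g. `n = ω` over `ℂ` = holomorphic) with a continuous action of a topological
group `G`:

* `contMDiff_smul_of_actsBy` / `actsBy_of_contMDiff_smul` / **`actsBy_iff_contMDiff_smul`**: "`G` acts by maps of
  `contDiffGroupoid n I`" (the hypothesis `ActsBy` of the quotient-manifold engine `QuotientManifold` /
  `QuotientHolomorphic`) is EQUIVALENT to "every `g • ·` is `C^n`"; `actsBy_of_le` (subgroups);
* `contMDiff_deckHom`, **`deckDiffeomorph`**: for `Γ₁ ⊴ Γ ≤ G` with `Γ₁` acting freely and properly discontinuously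
  and `Γ` acting by `C^n` maps, every deck transformation of `Γ₁\M` is a `C^n` DIFFEOMORPHISM;
* **quotient in stages as manifolds**: the deck group `D` acts on the manifold `Γ₁\M` by `C^n` maps
  (`actsBy_range_deckHom`), freely when `Γ` acts freely (`isCancelSMul_range_deckHom`), properly discontinuously when
  the index is finite (`properlyDiscontinuousSMul_range_deckHom`), so `(Γ₁\M)/D` is a `C^n` manifold
  (`isManifold_stagesQuotient`) and pv10-g4's `stagesHomeomorph : (Γ₁\M)/D ≃ₜ Γ\M` is a `C^n` DIFFEOMORPHISM
  (`stagesDiffeomorph`).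

The ball / PerL specialisation (biholomorphic deck transformations of `Γ₁\𝔹²`, the Galois record `IsHolGalois`,
`HermSpace3.exists_ballPieces_galoisCovering`) is the companion file `BallGaloisCovering`.
`#print axioms` of every result = `[propext, Classical.choice, Quot.sound]`.
-/

open scoped Matrix Pointwise Manifold ContDiff Topology
open MulAction Set

namespace HodgeCM.PerL34.QuotientManifold

variable {G : Type*} [Group G] {M : Type*} [TopologicalSpace M] [MulAction G M]
  {H : Type*} [TopologicalSpace H] [ChartedSpace H M]

section ActsBySmooth

variable [ContinuousConstSMul G M] {𝕜 : Type*} [NontriviallyNormedField 𝕜] {E : Type*} [NormedAddCommGroup E] [NormedSpace 𝕜 E]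
  {I : ModelWithCorners 𝕜 E H} {n : WithTop ℕ∞} [IsManifold I n M]

/-- If `G` acts by maps of `contDiffGroupoid n I` (in the chart sense `ActsBy`), every `g • ·` is `C^n`. -/
theorem contMDiff_smul_of_actsBy (hG : ActsBy G M (contDiffGroupoid n I)) (g : G) :
    ContMDiff I I n (fun x : M => g • x) := by
  intro x
  set c := chartAt H x with hc_def
  set c' := chartAt H (g • x) with hc'_def
  set φ := c.symm.trans ((Homeomorph.smul g : M ≃ₜ M).toOpenPartialHomeomorph.trans c') with hφ_def
  have hφ : φ ∈ contDiffGroupoid n I := hG g c (chart_mem_atlas H x) c' (chart_mem_atlas H (g • x))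
  have hφy : ∀ y ∈ c.source, φ (c y) = c' (g • y) := fun y hy => by
    simp only [hφ_def, OpenPartialHomeomorph.trans_apply, Homeomorph.toOpenPartialHomeomorph_apply,
      Homeomorph.smul_apply, OpenPartialHomeomorph.left_inv _ hy]
  have hsrc : ∀ y ∈ c.source, g • y ∈ c'.source → c y ∈ φ.source := fun y hy hy' => by
    simp only [hφ_def, OpenPartialHomeomorph.trans_source, OpenPartialHomeomorph.symm_source, mem_inter_iff,
      mem_preimage, Homeomorph.toOpenPartialHomeomorph_source, mem_univ, true_and,
      Homeomorph.toOpenPartialHomeomorph_apply, Homeomorph.smul_apply, OpenPartialHomeomorph.left_inv _ hy]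
    exact ⟨c.map_source hy, hy'⟩
  have h1 : ContMDiffAt I I n c x :=
    contMDiffAt_of_mem_maximalAtlas (IsManifold.chart_mem_maximalAtlas x) (mem_chart_source H x)
  have h2 : ContMDiffAt I I n φ (c x) :=
    (contMDiffOn_of_mem_contDiffGroupoid hφ).contMDiffAt
      (φ.open_source.mem_nhds (hsrc x (mem_chart_source H x) (mem_chart_source H (g • x))))
  have h3 : ContMDiffAt I I n c'.symm (φ (c x)) := by
    rw [hφy x (mem_chart_source H x)]
    exact contMDiffAt_symm_of_mem_maximalAtlas (IsManifold.chart_mem_maximalAtlas (g • x))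
      (mem_chart_target H (g • x))
  refine (h3.comp x (h2.comp x h1)).congr_of_eventuallyEq ?_
  have e1 : ∀ᶠ y in 𝓝 x, y ∈ c.source := c.open_source.mem_nhds (mem_chart_source H x)
  have e2 : ∀ᶠ y in 𝓝 x, g • y ∈ c'.source :=
    (continuous_const_smul g).continuousAt.preimage_mem_nhds (c'.open_source.mem_nhds (mem_chart_source H (g • x)))
  filter_upwards [e1, e2] with y hy hy'
  simp only [Function.comp_apply, hφy y hy, OpenPartialHomeomorph.left_inv _ hy']

/-- Conversely: if every `g • ·` is `C^n`, then `G` acts by maps of `contDiffGroupoid n I` in the chart sense. -/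
theorem actsBy_of_contMDiff_smul (h : ∀ g : G, ContMDiff I I n (fun x : M => g • x)) :
    ActsBy G M (contDiffGroupoid n I) := by
  intro g e he e' he'
  have hφ : ((Homeomorph.smul g : M ≃ₜ M).toOpenPartialHomeomorph.trans e') ∈
      IsManifold.maximalAtlas I n M := by
    refine OpenPartialHomeomorph.mem_maximalAtlas_of_contMDiffOn _ ?_ ?_
    · have hc : ContMDiffOn I I n (e' ∘ fun x : M => g • x) ((fun x : M => g • x) ⁻¹' e'.source) :=
        (contMDiffOn_of_mem_maximalAtlas (IsManifold.subset_maximalAtlas he')).comp (h g).contMDiffOn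
          subset_rfl
      refine (hc.mono ?_).congr fun y _ => rfl
      intro y hy
      rw [OpenPartialHomeomorph.trans_source] at hy
      exact hy.2
    · have hc : ContMDiffOn I I n ((fun x : M => g⁻¹ • x) ∘ e'.symm) e'.target :=
        (h g⁻¹).contMDiffOn.comp (t := univ)
          (contMDiffOn_symm_of_mem_maximalAtlas (IsManifold.subset_maximalAtlas he')) fun _ _ => mem_univ _
      refine (hc.mono ?_).congr fun y _ => rfl
      intro y hy
      rw [OpenPartialHomeomorph.trans_target] at hy
      exact hy.1
  exact StructureGroupoid.compatible_of_mem_maximalAtlas (IsManifold.subset_maximalAtlas he) hφ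

/-- **`ActsBy G M (contDiffGroupoid n I)` ⟺ every `g • ·` is `C^n`.** -/
theorem actsBy_iff_contMDiff_smul :
    ActsBy G M (contDiffGroupoid n I) ↔ ∀ g : G, ContMDiff I I n (fun x : M => g • x) :=
  ⟨contMDiff_smul_of_actsBy, actsBy_of_contMDiff_smul⟩

end ActsBySmooth

/-! ## §2  Deck transformations of `Γ₁\M` are `C^n` diffeomorphisms -/

section Deck

open HodgeCM.PerL34.Godement.Stages

/- `G` a topological group acting continuously: then every subgroup acts continuously (Mathlib's
`Submonoid.continuousSMul`), which the quotient-manifold structures of `Γ₁\M`, `Γ\M` need. -/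
variable [TopologicalSpace G] [ContinuousSMul G M] {Γ₁ Γ : Subgroup G}

/-- A subgroup of a group acting by `Gr`-maps acts by `Gr`-maps. -/
theorem actsBy_of_le {Gr : StructureGroupoid H} (hle : Γ₁ ≤ Γ) (hG : ActsBy Γ M Gr) : ActsBy Γ₁ M Gr :=
  fun γ e he e' he' => hG ⟨γ, hle γ.2⟩ e he e' he'

variable {𝕜 : Type*} [NontriviallyNormedField 𝕜] {E : Type*} [NormedAddCommGroup E] [NormedSpace 𝕜 E]
  {I : ModelWithCorners 𝕜 E H} {n : WithTop ℕ∞} [IsManifold I n M]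
  [ProperlyDiscontinuousSMul Γ₁ M] [IsCancelSMul Γ₁ M] [T2Space M] [LocallyCompactSpace M]

/-- A translation `g • ·` by an element normalising `Γ₁`, descended to `Γ₁\M` (`deckFun`), is `C^n` as soon
as `g • ·` is. -/
theorem contMDiff_deckFun (hG₁ : ActsBy Γ₁ M (contDiffGroupoid n I)) {g : G}
    (hg : ∀ δ ∈ Γ₁, g * δ * g⁻¹ ∈ Γ₁) (hsm : ContMDiff I I n (fun x : M => g • x)) :
    ContMDiff I I n (deckFun Γ₁ g hg (X := M)) :=
  (contMDiff_comp_mk_iff hG₁).mp ((contMDiff_mk hG₁).comp hsm)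

/-- **Deck transformations are `C^n`**: for `Γ₁ ⊴ Γ` with `Γ` acting by `C^n` maps, every
`deckHom Γ₁ Γ hle γ : Γ₁\M → Γ₁\M` is `C^n`. -/
theorem contMDiff_deckHom (hG : ActsBy Γ M (contDiffGroupoid n I)) (hle : Γ₁ ≤ Γ) [(Γ₁.subgroupOf Γ).Normal]
    (γ : Γ) : ContMDiff I I n (deckHom Γ₁ Γ hle (X := M) γ) :=
  contMDiff_deckFun (actsBy_of_le hle hG) (fun _ hδ => conj_mem_of_normal_subgroupOf hle γ.2 hδ)
    (contMDiff_smul_of_actsBy hG γ)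

/-- **The deck transformation `[x] ↦ [γ • x]` as a `C^n` DIFFEOMORPHISM of `Γ₁\M`.** -/
def deckDiffeomorph (hG : ActsBy Γ M (contDiffGroupoid n I)) (hle : Γ₁ ≤ Γ) [(Γ₁.subgroupOf Γ).Normal]
    (γ : Γ) : orbitRel.Quotient Γ₁ M ≃ₘ^n⟮I, I⟯ orbitRel.Quotient Γ₁ M where
  toEquiv := deckHom Γ₁ Γ hle γ
  contMDiff_toFun := contMDiff_deckHom hG hle γ
  contMDiff_invFun := by
    have h := contMDiff_deckHom (I := I) (n := n) hG hle γ⁻¹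
    rw [map_inv] at h
    exact h

/-- The diffeomorphism `deckDiffeomorph hG hle γ` is pv10-g4's deck transformation `deckHom Γ₁ Γ hle γ` as a map. -/
@[simp] theorem deckDiffeomorph_apply (hG : ActsBy Γ M (contDiffGroupoid n I)) (hle : Γ₁ ≤ Γ)
    [(Γ₁.subgroupOf Γ).Normal] (γ : Γ) (q : orbitRel.Quotient Γ₁ M) :
    deckDiffeomorph hG hle γ q = deckHom Γ₁ Γ hle γ q := rfl

/-- `deckDiffeomorph hG hle γ` sends the orbit `[x]` to `[γ • x]`. -/
theorem deckDiffeomorph_mk (hG : ActsBy Γ M (contDiffGroupoid n I)) (hle : Γ₁ ≤ Γ)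
    [(Γ₁.subgroupOf Γ).Normal] (γ : Γ) (x : M) :
    deckDiffeomorph hG hle γ (Quotient.mk (orbitRel Γ₁ M) x) = Quotient.mk (orbitRel Γ₁ M) ((γ : G) • x) := rfl

end Deck

/-! ## §3  Quotient in stages `(Γ₁\M)/D ≅ Γ\M` as `C^n` manifolds -/

section Stages

open HodgeCM.PerL34.Godement.Stages

/-- A free action (all stabilizers trivial) is cancellative. -/
theorem isCancelSMul_of_stabilizer_eq_bot {Γ' T : Type*} [Group Γ'] [MulAction Γ' T]
    (h : ∀ t : T, stabilizer Γ' t = ⊥) : IsCancelSMul Γ' T := by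
  rw [isCancelSMul_iff_stabilizer_eq_bot]
  exact h

/-- A finite group acts properly discontinuously on any topological space. -/
theorem properlyDiscontinuousSMul_of_finite {Γ' T : Type*} [Group Γ'] [MulAction Γ' T] [TopologicalSpace T]
    [Finite Γ'] : ProperlyDiscontinuousSMul Γ' T :=
  ⟨fun _ _ => Set.toFinite _⟩

/-- The deck group acts freely on `Γ₁\M` when `Γ` acts freely on `M` (pv10-g4 `stabilizer_deck_eq_bot`). -/
theorem isCancelSMul_range_deckHom {X : Type*} [MulAction G X] {Γ₁ Γ : Subgroup G} (hle : Γ₁ ≤ Γ)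
    [(Γ₁.subgroupOf Γ).Normal] (hfree : ∀ x : X, stabilizer G x ⊓ Γ = ⊥) :
    IsCancelSMul (deckHom Γ₁ Γ hle (X := X)).range (orbitRel.Quotient Γ₁ X) :=
  isCancelSMul_of_stabilizer_eq_bot fun q => stabilizer_deck_eq_bot Γ₁ Γ hle hfree q

omit [ChartedSpace H M] in
/-- The deck group of a finite-index normal subgroup is finite, hence acts properly discontinuously. -/
theorem properlyDiscontinuousSMul_range_deckHom {Γ₁ Γ : Subgroup G} (hle : Γ₁ ≤ Γ)
    [(Γ₁.subgroupOf Γ).Normal] [(Γ₁.subgroupOf Γ).FiniteIndex] :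
    ProperlyDiscontinuousSMul (deckHom Γ₁ Γ hle (X := M)).range (orbitRel.Quotient Γ₁ M) :=
  haveI := finite_range_deckHom Γ₁ Γ hle (X := M)
  properlyDiscontinuousSMul_of_finite

variable [TopologicalSpace G] [ContinuousSMul G M] {Γ₁ Γ : Subgroup G}
variable {𝕜 : Type*} [NontriviallyNormedField 𝕜] {E : Type*} [NormedAddCommGroup E] [NormedSpace 𝕜 E]
  {I : ModelWithCorners 𝕜 E H} {n : WithTop ℕ∞} [IsManifold I n M]
  [ProperlyDiscontinuousSMul Γ₁ M] [IsCancelSMul Γ₁ M] [T2Space M] [LocallyCompactSpace M]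

omit [ChartedSpace H M] [IsManifold I n M] [ProperlyDiscontinuousSMul Γ₁ M] [IsCancelSMul Γ₁ M] [T2Space M] in
/-- `Γ₁\M` is locally compact. -/
theorem locallyCompactSpace_orbitRelQuotient : LocallyCompactSpace (orbitRel.Quotient Γ₁ M) :=
  (MulAction.isOpenQuotientMap_quotientMk (Γ := Γ₁) (T := M)).locallyCompactSpace

/-- **The deck group acts on the `C^n` manifold `Γ₁\M` by `C^n` maps.** -/
theorem actsBy_range_deckHom (hG : ActsBy Γ M (contDiffGroupoid n I)) (hle : Γ₁ ≤ Γ)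
    [(Γ₁.subgroupOf Γ).Normal] :
    ActsBy (deckHom Γ₁ Γ hle (X := M)).range (orbitRel.Quotient Γ₁ M) (contDiffGroupoid n I) := by
  haveI := isManifold_orbitRelQuotient I n (actsBy_of_le hle hG)
  refine actsBy_of_contMDiff_smul fun d => ?_
  obtain ⟨d, hd⟩ := d
  obtain ⟨γ, rfl⟩ := MonoidHom.mem_range.mp hd
  exact contMDiff_deckHom hG hle γ

/-- **Quotient in stages, manifold version**: `(Γ₁\M)/D` is a `C^n` manifold (for `Γ₁ ⊴ Γ` of finite index,
`Γ` acting freely by `C^n` maps). -/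
theorem isManifold_stagesQuotient (hG : ActsBy Γ M (contDiffGroupoid n I)) (hle : Γ₁ ≤ Γ)
    [(Γ₁.subgroupOf Γ).Normal] [(Γ₁.subgroupOf Γ).FiniteIndex] (hfree : ∀ x : M, stabilizer G x ⊓ Γ = ⊥) :
    haveI := properlyDiscontinuousSMul_range_deckHom (M := M) hle
    haveI := isCancelSMul_range_deckHom (X := M) hle hfree
    haveI := locallyCompactSpace_orbitRelQuotient (Γ₁ := Γ₁) (M := M)
    IsManifold I n (orbitRel.Quotient (deckHom Γ₁ Γ hle (X := M)).range (orbitRel.Quotient Γ₁ M)) := by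
  haveI := properlyDiscontinuousSMul_range_deckHom (M := M) hle
  haveI := isCancelSMul_range_deckHom (X := M) hle hfree
  haveI := locallyCompactSpace_orbitRelQuotient (Γ₁ := Γ₁) (M := M)
  haveI := isManifold_orbitRelQuotient I n (actsBy_of_le hle hG)
  exact isManifold_orbitRelQuotient I n (actsBy_range_deckHom hG hle)


variable [ProperlyDiscontinuousSMul Γ M] [IsCancelSMul Γ M]

/-- **`stagesMap : (Γ₁\\M)/D → Γ\\M` is `C^n`.** -/
theorem contMDiff_stagesMap (hG : ActsBy Γ M (contDiffGroupoid n I)) (hle : Γ₁ ≤ Γ)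
    [(Γ₁.subgroupOf Γ).Normal] [(Γ₁.subgroupOf Γ).FiniteIndex] (hfree : ∀ x : M, stabilizer G x ⊓ Γ = ⊥) :
    haveI := properlyDiscontinuousSMul_range_deckHom (M := M) hle
    haveI := isCancelSMul_range_deckHom (X := M) hle hfree
    haveI := locallyCompactSpace_orbitRelQuotient (Γ₁ := Γ₁) (M := M)
    ContMDiff I I n (stagesMap Γ₁ Γ hle (X := M)) := by
  haveI := properlyDiscontinuousSMul_range_deckHom (M := M) hle
  haveI := isCancelSMul_range_deckHom (X := M) hle hfree
  haveI := locallyCompactSpace_orbitRelQuotient (Γ₁ := Γ₁) (M := M)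
  haveI := isManifold_orbitRelQuotient I n (actsBy_of_le hle hG)
  have h1 : ContMDiff I I n (orbitMap Γ₁ Γ hle (X := M)) :=
    contMDiff_of_comp_mk_eq (actsBy_of_le hle hG) hG _ fun z => orbitMap_mk Γ₁ Γ hle z
  exact (contMDiff_comp_mk_iff (actsBy_range_deckHom hG hle)).mp h1

/-- **The inverse `Γ\\M → (Γ₁\\M)/D` of `stagesMap` is `C^n`.** -/
theorem contMDiff_stagesHomeomorph_symm (hG : ActsBy Γ M (contDiffGroupoid n I)) (hle : Γ₁ ≤ Γ)
    [(Γ₁.subgroupOf Γ).Normal] [(Γ₁.subgroupOf Γ).FiniteIndex] (hfree : ∀ x : M, stabilizer G x ⊓ Γ = ⊥) :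
    haveI := properlyDiscontinuousSMul_range_deckHom (M := M) hle
    haveI := isCancelSMul_range_deckHom (X := M) hle hfree
    haveI := locallyCompactSpace_orbitRelQuotient (Γ₁ := Γ₁) (M := M)
    ContMDiff I I n (stagesHomeomorph Γ₁ Γ hle (X := M)).symm := by
  haveI := properlyDiscontinuousSMul_range_deckHom (M := M) hle
  haveI := isCancelSMul_range_deckHom (X := M) hle hfree
  haveI := locallyCompactSpace_orbitRelQuotient (Γ₁ := Γ₁) (M := M)
  haveI := isManifold_orbitRelQuotient I n (actsBy_of_le hle hG)
  haveI := isManifold_orbitRelQuotient I n (actsBy_range_deckHom hG hle)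
  have hD := actsBy_range_deckHom (I := I) (n := n) hG hle
  -- `σ ∘ π_Γ = π_D ∘ π_{Γ₁}`, which is `C^n`; descend along `π_Γ`.
  refine (contMDiff_comp_mk_iff hG).mp ?_
  have heq : ((stagesHomeomorph Γ₁ Γ hle (X := M)).symm ∘ Quotient.mk (orbitRel Γ M)) =
      (Quotient.mk (orbitRel _ (orbitRel.Quotient Γ₁ M)) ∘ Quotient.mk (orbitRel Γ₁ M)) := by
    funext x
    rw [Function.comp_apply, Function.comp_apply, Homeomorph.symm_apply_eq, stagesHomeomorph_apply,
      stagesMap_mk, orbitMap_mk]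
  rw [heq]
  exact (contMDiff_mk hD).comp (contMDiff_mk (actsBy_of_le hle hG))

/-- **Quotient in stages as `C^n` manifolds: `(Γ₁\\M)/D ≃ₘ Γ\\M`** — pv10-g4's `stagesHomeomorph` is a `C^n`
diffeomorphism (`Γ₁ ⊴ Γ` of finite index, `Γ` acting freely and properly discontinuously by `C^n` maps;
`D ≅ Γ/Γ₁` the finite deck group acting freely by the `C^n` diffeomorphisms `deckDiffeomorph`). -/
noncomputable def stagesDiffeomorph (hG : ActsBy Γ M (contDiffGroupoid n I)) (hle : Γ₁ ≤ Γ)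
    [(Γ₁.subgroupOf Γ).Normal] [(Γ₁.subgroupOf Γ).FiniteIndex] (hfree : ∀ x : M, stabilizer G x ⊓ Γ = ⊥) :
    haveI := properlyDiscontinuousSMul_range_deckHom (M := M) hle
    haveI := isCancelSMul_range_deckHom (X := M) hle hfree
    haveI := locallyCompactSpace_orbitRelQuotient (Γ₁ := Γ₁) (M := M)
    orbitRel.Quotient (deckHom Γ₁ Γ hle (X := M)).range (orbitRel.Quotient Γ₁ M) ≃ₘ^n⟮I, I⟯
      orbitRel.Quotient Γ M :=
  haveI := properlyDiscontinuousSMul_range_deckHom (M := M) hle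
  haveI := isCancelSMul_range_deckHom (X := M) hle hfree
  haveI := locallyCompactSpace_orbitRelQuotient (Γ₁ := Γ₁) (M := M)
  { toEquiv := (stagesHomeomorph Γ₁ Γ hle (X := M)).toEquiv
    contMDiff_toFun := by
      change ContMDiff I I n (stagesHomeomorph Γ₁ Γ hle (X := M))
      exact (contMDiff_stagesMap hG hle hfree).congr fun q => stagesHomeomorph_apply Γ₁ Γ hle q
    contMDiff_invFun := contMDiff_stagesHomeomorph_symm hG hle hfree }

end Stages

end HodgeCM.PerL34.QuotientManifold

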